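import Literature.AlgebraicGeometry.Resolution.StrictTransformApproximation
import Literature.AlgebraicGeometry.Resolution.MonomialAdjugate
import Mathlib.RingTheory.LocalRing.MaximalIdeal.Basic
import Mathlib.RingTheory.Ideal.Maps
import Mathlib.Algebra.Ring.Subring.Basic
import HarnessLib

/-!
# [CoP1] Prop. 9.3, decomposition layer: the elements `Fᵢ, Hⱼ ∈ M ∩ S′` with `√((F, H) S′) = 𝔪_{S′}`

Topic: `Literature/AlgebraicGeometry/Resolution`. PROOF side of `CossartPiltant2019ReductionP`
(`ArithmeticalThreefoldsLocal.lean`), input (C4), hypothesis `hDec` of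
`cossartPiltant2019ReductionP_of_cjs_of_stableInertiaHensel` ([CoP1] Prop. 9.3 for
`M ≤ K′ ≤ Kˢ`). This file assembles steps (46)–(52) of the printed proof (HAL pp. 27–28) into
ONE statement about subrings of a field `E`:

> `R₁ ⊆ M` (a local model of `M`), `R₁ ⊆ R₁′ ⊆ S′` (`R₁′` the model of `K′` above `R₁`, `S′` a
> regular local model of `K′` with regular parameters `x₀, x₁, x₂`), `R₁` dense in `R₁′` for the
> `𝔪_{R₁′}`-adic topology, `𝔪_{R₁′} S′ ⊆ (x₀ ⋯ x_{r-1}) S′`, monomial elements `fᵢ ∈ M`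
> (`i < r`) with independent exponent vectors, and for `j ≥ r` an element `gⱼ ∈ R₁′` whose strict
> transform in `S′` is `xⱼ` up to a unit. THEN there are `Fᵢ, Hⱼ ∈ M ∩ 𝔪_{S′}` with
> `√((F₀, …, F_{r-1}, H_r, …, H₂) S′) = 𝔪_{S′}`.

(`exists_radical_eq_maximalIdeal_of_dense`). The ingredients are the landed bricks
`exists_unit_mul_pow_mem_subfield` ((46), `MonomialAdjugate.lean`),
`exists_strictTransform_of_sub_mem` ((48)–(51)) and `radical_eq_of_isUnit_mul_pow_mem` ((52),
`StrictTransformApproximation.lean`), and `pow_div_prod_pow_eq` ((49)). No valuation appears: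
the two facts about the valuation that the printed proof uses here are encoded as
`𝔪_{R₁′} ↦ (x₀ ⋯ x_{r-1}) S′` (hypothesis `ha`) and the density statement (hypothesis `hdense`,
the output of `exists_finset_dense_locAtCentre`, `DecompositionLayerDensity.lean`).

Everything is PROVED; no named facts, definitions, instances or notation are introduced.

## Sources

* V. Cossart, O. Piltant, J. Algebra 320 (2008) 1051–1082: proof of Prop. 9.3, (46)–(52)
  (HAL hal-00139124, pp. 27–28). [CossartPiltant2008]
* V. Cossart, O. Piltant, J. Algebra 529 (2019) = arXiv:1412.0868: proof of Prop. 4.6,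
  (5101)–(5102) (arXiv v1 p. 53) — the structural twin. [CossartPiltant2019]
-/

noncomputable section

open IsLocalRing

namespace Literature.AlgebraicGeometry.Resolution

universe u

variable {E : Type u} [Field E]

/-- The inverse of a unit of a subring of a field, read in the field, is the field inverse.
[folklore] -/
private theorem coe_units_inv_eq_inv (S' : Subring E) (U : S'ˣ) :
    (((U⁻¹ : S'ˣ) : S') : E) = (((U : S'ˣ) : S') : E)⁻¹ := by
  have h : ((U : S') : E) * (((U⁻¹ : S'ˣ) : S') : E) = 1 := by
    rw [← Subring.coe_mul, Units.mul_inv, Subring.coe_one]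
  exact eq_inv_of_mul_eq_one_right h

/-- **Density read in `S′`.** If `R₁` is `𝔪_{R₁′}`-adically dense in `R₁′ ⊆ S′` and
`𝔪_{R₁′}` maps into the principal ideal `P S′`, then every `g ∈ R₁′` is congruent modulo
`Pⁿ S′` to an element of `S′` lying in `R₁` ([CoP1] (48): "take `hⱼ ∈ R₁` such that
`hⱼ − gⱼ ∈ m_{R₁′}^{C+1}`", combined with (50) `m_{R₁′} S′ ⊆ (x₁ ⋯ x_r)`).
[cite: CossartPiltant2008, proof of Prop. 9.3, (48) and (50) (HAL p. 28)] -/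
theorem exists_mem_sub_mem_span_pow_of_dense (S' R₁' : Subring E) [IsLocalRing S']
    [IsLocalRing R₁'] (h₁ : R₁' ≤ S') (R₁ : Subring E)
    (hdense : ∀ (n : ℕ) (y : E), y ∈ R₁' →
      ∃ a ∈ R₁, ∃ z : R₁', z ∈ maximalIdeal R₁' ^ n ∧ (z : E) = y - a)
    (P : S') (hP : ∀ z : R₁', z ∈ maximalIdeal R₁' → Subring.inclusion h₁ z ∈ Ideal.span {P})
    (n : ℕ) (g : S') (hg : (g : E) ∈ R₁') :
    ∃ h : S', (h : E) ∈ R₁ ∧ h - g ∈ Ideal.span {P ^ n} := by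
  obtain ⟨a, haR₁, z, hz, hza⟩ := hdense n g hg
  refine ⟨g - Subring.inclusion h₁ z, ?_, ?_⟩
  · have : ((g - Subring.inclusion h₁ z : S') : E) = a := by
      rw [AddSubgroupClass.coe_sub, Subring.coe_inclusion, hza]; ring
    rw [this]; exact haR₁
  · have hmap : (maximalIdeal R₁' ^ n).map (Subring.inclusion h₁) ≤ Ideal.span {P ^ n} := by
      rw [Ideal.map_pow, ← Ideal.span_singleton_pow]
      exact Ideal.pow_right_mono
        (Ideal.map_le_iff_le_comap.mpr fun z hz => Ideal.mem_comap.mpr (hP z hz)) n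
    have hz' : Subring.inclusion h₁ z ∈ Ideal.span {P ^ n} := hmap (Ideal.mem_map_of_mem _ hz)
    have : g - Subring.inclusion h₁ z - g = -Subring.inclusion h₁ z := by ring
    rw [this]
    exact (Ideal.span {P ^ n}).neg_mem hz'

set_option maxHeartbeats 800000 in
/-- **[CoP1] Prop. 9.3, (46)–(52) assembled.** Let `S′` be a local subring of a field `E` whose
maximal ideal is generated by `x₀, x₁, x₂` (all non-zero), `K` a subfield (the field `M` of the
source), `R₁ ⊆ K` a subring, `R₁′` a local subring with `R₁′ ⊆ S′`, `R₁` dense in `R₁′` for the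
`𝔪_{R₁′}`-adic topology, and `0 < r ≤ 3` such that: (a) `𝔪_{R₁′} S′ ⊆ (x₀ ⋯ x_{r-1}) S′`;
(b) there are `fᵢ ∈ K` (`i < r`) with `fᵢ = γᵢ ∏_{j<r} xⱼ^{aᵢⱼ}`, `γᵢ` units of `S′`,
`det(aᵢⱼ) ≠ 0`; (c) for `r ≤ j < 3` there is `gⱼ ∈ R₁′` with `gⱼ = uⱼ xⱼ ∏_{i<r} xᵢ^{cⱼᵢ}`,
`uⱼ` a unit of `S′`. THEN there are `D > 0`, `Fᵢ ∈ K ∩ 𝔪_{S′}` (`i < r`) and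
`Hⱼ ∈ K ∩ 𝔪_{S′}` (`r ≤ j < 3`) with `√((Fᵢ, Hⱼ) S′) = 𝔪_{S′}`. Proof = the printed one:
`Fᵢ = unit · xᵢ^D` by the adjugate (46); `hⱼ ∈ R₁` with `hⱼ ≡ gⱼ mod 𝔪_{R₁′}^{C+1}`,
`C ≥ cⱼᵢ` (48), so `hⱼ ≡ gⱼ mod (x₀⋯x_{r-1})^{C+1}` in `S′` (50), `hⱼ = h′ⱼ ∏ xᵢ^{cⱼᵢ}` with
`h′ⱼ ≡ uⱼxⱼ mod (x₀⋯x_{r-1})` (51), `Hⱼ := hⱼ^D / ∏ Fᵢ^{cⱼᵢ} = unit · (h′ⱼ)^D` (49), and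
`(x_{<r}, uⱼxⱼ) = 𝔪_{S′}` gives the radical (52).
[cite: CossartPiltant2008, proof of Prop. 9.3, (46)–(52) (HAL pp. 27–28)]
[cite: CossartPiltant2019, proof of Prop. 4.6, (5101)–(5102) (arXiv v1 p. 53)] -/
theorem exists_radical_eq_maximalIdeal_of_dense
    (S' R₁' : Subring E) [IsLocalRing S'] [IsLocalRing R₁'] (h₁ : R₁' ≤ S')
    (R₁ : Subring E) (K : Subfield E) (hR₁K : R₁ ≤ K.toSubring)
    (hdense : ∀ (n : ℕ) (y : E), y ∈ R₁' →
      ∃ a ∈ R₁, ∃ z : R₁', z ∈ maximalIdeal R₁' ^ n ∧ (z : E) = y - a)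
    {r : ℕ} (hr : r ≤ 3) (hr0 : 0 < r) (x : Fin 3 → S') (hx0 : ∀ j, ((x j : S') : E) ≠ 0)
    (hxm : Ideal.span (Set.range x) = maximalIdeal S')
    (ha : ∀ z : R₁', z ∈ maximalIdeal R₁' →
      Subring.inclusion h₁ z ∈ Ideal.span {∏ i : Fin r, x (Fin.castLE hr i)})
    (γ : Fin r → S'ˣ) (A : Matrix (Fin r) (Fin r) ℕ)
    (hdet : (A.map (fun n : ℕ => (n : ℤ))).det ≠ 0)
    (f : Fin r → E) (hfK : ∀ i, f i ∈ K)
    (hf : ∀ i, f i = ((γ i : S') : E) * ∏ j, ((x (Fin.castLE hr j) : S') : E) ^ A i j)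
    (hg : ∀ j : Fin 3, r ≤ (j : ℕ) → ∃ (g : E) (w : S'ˣ) (c : Fin r → ℕ), g ∈ R₁' ∧
      g = ((w : S') : E) * ((x j : S') : E) * ∏ i, ((x (Fin.castLE hr i) : S') : E) ^ c i) :
    ∃ (D : ℕ) (_ : 0 < D) (F : Fin r → S') (H : {j : Fin 3 // r ≤ (j : ℕ)} → S'),
      (∀ i, (F i : E) ∈ K) ∧ (∀ j, (H j : E) ∈ K) ∧
      (∀ i, F i ∈ maximalIdeal S') ∧ (∀ j, H j ∈ maximalIdeal S') ∧
      (Ideal.span (Set.range F ∪ Set.range H)).radical = maximalIdeal S' := by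
  classical
  -- the exceptional parameters `x₀, …, x_{r-1}`
  set xr : Fin r → S' := fun i => x (Fin.castLE hr i) with hxr_def
  have hxr0 : ∀ j, ((xr j : S') : E) ≠ 0 := fun j => hx0 _
  have hxmem : ∀ j, x j ∈ maximalIdeal S' := fun j => by
    rw [← hxm]; exact Ideal.subset_span ⟨j, rfl⟩
  have hspan_le : Ideal.span (Set.range xr) ≤ maximalIdeal S' :=
    Ideal.span_le.mpr (by rintro _ ⟨i, rfl⟩; exact hxmem _)
  have hprod_mem : (∏ i, xr i) ∈ Ideal.span (Set.range xr) := by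
    have hi₀ : (⟨0, hr0⟩ : Fin r) ∈ Finset.univ := Finset.mem_univ _
    rw [← Finset.prod_erase_mul _ _ hi₀]
    exact Ideal.mul_mem_left _ _ (Ideal.subset_span ⟨_, rfl⟩)
  have hprod_span_le : Ideal.span {∏ i, xr i} ≤ Ideal.span (Set.range xr) :=
    (Ideal.span_singleton_le_iff_mem _).mpr hprod_mem
  have hprod_m : (∏ i, xr i) ∈ maximalIdeal S' := hspan_le hprod_mem
  /- (46): `Fᵢ = uᵢ xᵢ^D ∈ K` -/
  have hf' : ∀ i, f i = ((γ i : S') : E) *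
      ∏ j, ((xr j : S') : E) ^ (A.map (fun n : ℕ => (n : ℤ))) i j := by
    intro i
    rw [hf i]
    congr 1
    refine Finset.prod_congr rfl fun j _ => ?_
    rw [Matrix.map_apply, zpow_natCast]
  obtain ⟨D, hD, F, u, hFK, hF⟩ :=
    exists_unit_mul_pow_mem_subfield S' K xr hxr0 γ _ hdet f hfK hf'
  let F' : Fin r → S' := fun i => (u i : S') * xr i ^ D
  have hF'E : ∀ i, ((F' i : S') : E) = F i := by
    intro i
    rw [hF i]
    simp only [F', Subring.coe_mul, Subring.coe_pow]
  have hF'm : ∀ i, F' i ∈ maximalIdeal S' := fun i =>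
    Ideal.mul_mem_left _ _ (Ideal.pow_mem_of_mem _ (hxmem _) D hD)
  /- (47)–(48): the elements `gⱼ ∈ R₁′` and their approximations `hⱼ ∈ R₁` -/
  have hg' : ∀ j : {j : Fin 3 // r ≤ (j : ℕ)}, ∃ (g : E) (w : S'ˣ) (c : Fin r → ℕ), g ∈ R₁' ∧
      g = ((w : S') : E) * ((x j.1 : S') : E) * ∏ i, ((xr i : S') : E) ^ c i :=
    fun j => hg j.1 j.2
  choose g w c hgR hgE using hg'
  -- `gⱼ` as an element of `S′`, in product form
  have hgS : ∀ j, (⟨g j, h₁ (hgR j)⟩ : S') = ((w j : S') * x j.1) * ∏ i, xr i ^ c j i := by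
    intro j
    apply Subtype.ext
    push_cast
    exact hgE j
  -- (48)+(50)+(51): `hⱼ ∈ R₁`, `hⱼ = h′ⱼ ∏ xᵢ^{cⱼᵢ}`, `h′ⱼ ≡ wⱼ xⱼ mod (x₀⋯x_{r-1})`
  have hstrict : ∀ j, ∃ hj h'j : S', (hj : E) ∈ R₁ ∧ hj = h'j * ∏ i, xr i ^ c j i ∧
      h'j - (w j : S') * x j.1 ∈ Ideal.span {∏ i, xr i} := by
    intro j
    set C : ℕ := Finset.univ.sup (c j) with hC
    have hcC : ∀ i, c j i ≤ C := fun i => Finset.le_sup (f := c j) (Finset.mem_univ i)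
    obtain ⟨hj, hjR₁, hjg⟩ := exists_mem_sub_mem_span_pow_of_dense S' R₁' h₁ R₁ hdense
      (∏ i, xr i) ha (C + 1) ⟨g j, h₁ (hgR j)⟩ (hgR j)
    obtain ⟨h'j, hhj, hh'j⟩ := exists_strictTransform_of_sub_mem xr (c j) C hcC
      (⟨g j, h₁ (hgR j)⟩ : S') ((w j : S') * x j.1) hj (hgS j) hjg
    exact ⟨hj, h'j, hjR₁, hhj, hh'j⟩
  choose hh h' hhR₁ hhh' hh'g using hstrict
  have hh'm : ∀ j, h' j ∈ maximalIdeal S' := by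
    intro j
    have : h' j = (h' j - (w j : S') * x j.1) + (w j : S') * x j.1 := by ring
    rw [this]
    exact Ideal.add_mem _ (hspan_le (hprod_span_le (hh'g j))) (Ideal.mul_mem_left _ _ (hxmem _))
  /- (49): `Hⱼ := hⱼ^D / ∏ Fᵢ^{cⱼᵢ} = unit · (h′ⱼ)^D ∈ K` -/
  let U : {j : Fin 3 // r ≤ (j : ℕ)} → S'ˣ := fun j => ∏ i, u i ^ c j i
  let H' : {j : Fin 3 // r ≤ (j : ℕ)} → S' := fun j => ((U j)⁻¹ : S'ˣ) * h' j ^ D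
  have hUE : ∀ j, (((U j : S'ˣ) : S') : E) = ∏ i, (((u i : S'ˣ) : S') : E) ^ c j i := by
    intro j
    simp only [U, Units.coe_prod, Units.val_pow_eq_pow_val]
    push_cast
    rfl
  have hH'E : ∀ j, ((H' j : S') : E) = ((hh j : S') : E) ^ D / ∏ i, F i ^ c j i := by
    intro j
    have hu0 : ∀ i, (((u i : S'ˣ) : S') : E) ≠ 0 := by
      intro i h0
      have : ((u i : S'ˣ) : S') = 0 := Subtype.ext h0
      exact (u i).ne_zero this
    have hhjE : ((hh j : S') : E) = ((h' j : S') : E) * ∏ i, ((xr i : S') : E) ^ c j i := by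
      have := congrArg (fun t : S' => (t : E)) (hhh' j)
      push_cast at this
      exact this
    rw [pow_div_prod_pow_eq D (fun i => ((xr i : S') : E)) (fun i => (((u i : S'ˣ) : S') : E))
      F (c j) hxr0 hu0 hF _ _ hhjE]
    simp only [H', Subring.coe_mul, Subring.coe_pow, coe_units_inv_eq_inv, hUE]
  have hH'K : ∀ j, ((H' j : S') : E) ∈ K := by
    intro j
    rw [hH'E j]
    exact div_mem (pow_mem (hR₁K (hhR₁ j)) D)
      (prod_mem fun i _ => pow_mem (hFK i) _)
  have hH'm : ∀ j, H' j ∈ maximalIdeal S' := fun j =>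
    Ideal.mul_mem_left _ _ (Ideal.pow_mem_of_mem _ (hh'm j) D hD)
  /- (52): the radical -/
  let g' : {j : Fin 3 // r ≤ (j : ℕ)} → S' := fun j => (w j : S') * x j.1
  have h𝔪 : Ideal.span (Set.range xr ∪ Set.range g') = maximalIdeal S' := by
    refine le_antisymm (Ideal.span_le.mpr ?_) ?_
    · rintro _ (⟨i, rfl⟩ | ⟨j, rfl⟩)
      · exact hxmem _
      · exact Ideal.mul_mem_left _ _ (hxmem _)
    · rw [← hxm]
      refine Ideal.span_le.mpr ?_
      rintro _ ⟨k, rfl⟩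
      by_cases hk : (k : ℕ) < r
      · have hk' : Fin.castLE hr ⟨k, hk⟩ = k := Fin.ext rfl
        have : x k = xr ⟨k, hk⟩ := by simp only [hxr_def, hk']
        rw [SetLike.mem_coe, this]
        exact Ideal.subset_span (Or.inl ⟨_, rfl⟩)
      · have hrk : r ≤ (k : ℕ) := not_lt.mp hk
        have : x k = ((w ⟨k, hrk⟩)⁻¹ : S'ˣ) * g' ⟨k, hrk⟩ := by
          simp only [g', ← mul_assoc, Units.inv_mul, one_mul]
        rw [SetLike.mem_coe, this]
        exact Ideal.mul_mem_left _ _ (Ideal.subset_span (Or.inr ⟨_, rfl⟩))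
  have hI : Ideal.span (Set.range F' ∪ Set.range H') ≤ maximalIdeal S' := by
    refine Ideal.span_le.mpr ?_
    rintro _ (⟨i, rfl⟩ | ⟨j, rfl⟩)
    · exact hF'm i
    · exact hH'm j
  have hrad := radical_eq_of_isUnit_mul_pow_mem xr g' (Ideal.span (Set.range F' ∪ Set.range H'))
    (maximalIdeal S') h𝔪 hI D
    (fun i => ⟨(u i : S'), Units.isUnit _, Ideal.subset_span (Or.inl ⟨i, rfl⟩)⟩)
    (fun j => ⟨(((U j)⁻¹ : S'ˣ) : S'), h' j, Units.isUnit _,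
      Ideal.subset_span (Or.inr ⟨j, rfl⟩), hprod_span_le (hh'g j)⟩)
  exact ⟨D, hD, F', H', fun i => (hF'E i) ▸ hFK i, hH'K, hF'm, hH'm, hrad⟩

end Literature.AlgebraicGeometry.Resolution

end
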